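import Summits.HodgeConjecture.HodgeConjecture.Theorems.R90S3TransportRhoPacket
import Literature.NumberTheory.Automorphic.IrreducibleClassesComapSpherical
import Literature.NumberTheory.Automorphic.LocalUnitaryGroupCongr
import HarnessLib

/-!
# R90 · S3 · FILE G brick G4 — Rogawski `H_v`-packets are transported along a ground-field change

R90-TF SLAB, section S3 (Rogawski Ch. 13.2 «Endo-H»), dealer R90-C12-plan (g2) «BUNDLE 1»; seat K2E3-p36 (g3); crux H413 =
`stmt-HodgeConjecture-24833`, route `HCCMUnconditional`, lane `--supports … --as helper` (count-neutral).  PAYS, IN NAME-SHAPE, G4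
`stub_R90_S3_transport_rogPacketH` (`Cruxes/H413/Lines/R90_S3_LocalTransportWaveG.lean` :351, ED. 3 7e1bdc0be15c4802) ← `rogPacketH_transport`:
an `H_v`-packet `S = O ⊠ χ₁` (`O` the similitude-conjugation orbit of an ADMISSIBLE class `σ₀` of `U(Φ₂)(L⁺_v)`, ★ S4-B `IsRogPacketH`) goes along
`(Φ, e₂, e₁, e_H)` to the `H′_{v′}`-packet `(e₂∗O) ⊠ (χ₁ ∘ e₁⁻¹)`: `e₂∗O` is the orbit of `σ₀ ∘ e₂⁻¹` (admissible, ★ `IrrClass.IsAdmissible.comap`), because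
conjugation by a similitude `T` of `(Φ₂)_v` (`ᵗT̄ Φ₂ T = a Φ₂`) is carried by `e₂ = GL₂(Φ)` to conjugation by the similitude `GL₂(Φ) T` of `(Φ₂)_{v′}`
(`ᵗ(ΦT)‾ Φ₂ (ΦT) = Φ(a) Φ₂`, `formCongr_map_of_intertwines`; `e₂ ∘ Ad(T) = Ad(ΦT) ∘ e₂` on matrices by the kit's `transport_symm_val`), and conversely
by `Φ⁻¹`; the box by ★ `comap_boxChar_eq` (brick G3c).  As for every S4-lane payer, file B's `IsRogPacketH ∕ IsRogPacketU2 ∕ IsU2SimilConj` (Lines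
vocabulary, L9 «defs down») are UNFOLDED byte for byte in hypothesis and conclusion (precedent ★ `R90S4HAdmissible`), so the socket closes by `exact`.
One direction (the converse is the socket at the reversed datum); dead frame binders `_hc _hc' _hΦμ _he₁` carried.  ★-ONLY IMPORTS; theorems only
(no `def`, no instance, no notation, no `sorry`); NOT a print input.

HONEST LABEL: HC_CM is proved only modulo the 7 printed citations (2 remaining named inputs: hLiu418 = stmt-HodgeConjecture-24832,
h413 = stmt-HodgeConjecture-24833) until rung 0 closes; pure transport of structure; pays G4 only when ★ AND the next G edition plugs it and is BUILT; G is
off the rung-0 path except via S10's file U.  REL ≠ ★ ≠ BUILT.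

## References
* [Rogawski1990] J. D. Rogawski, *Automorphic Representations of Unitary Groups in Three Variables*, Ann. of Math. Stud. 123 (1990), §11.1 p. 161
  («an L-packet on `U(2)` is a `PGL₂(F)`-orbit»), §12.1 pp. 171–172 (`ρ = ρ₁ ⊗ χ`), §14.2 p. 232 («`G′_v ≃ G_v`»).
* [PlatonovRapinchuk1994] V. Platonov, A. Rapinchuk, *Algebraic Groups and Number Theory* (1994), §2.3 (similitudes) · [BushnellHenniart2006] §1.1, §9.1.
-/

set_option autoImplicit false
-- the mandated namespace repeats the single-problem summit's segment (`HodgeConjecture.HodgeConjecture`)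
set_option linter.dupNamespace false

noncomputable section

open NumberField IsDedekindDomain
open scoped Matrix MatrixGroups
open Literature.NumberTheory.Automorphic Literature.NumberTheory.Automorphic.UnitaryGroup Literature.NumberTheory.GaloisRepresentations

namespace Summit.HodgeConjecture.HodgeConjecture.R90.S3

/-! ## §0 Similitudes of a form are carried by a ring isomorphism intertwining the involutions -/

/-- **`Φ(ᵗT̄ H T) = ᵗ(ΦT)‾ (ΦH) (ΦT)`**: for `Φ : R ≃+* S` with `Φ ∘ σ = τ ∘ Φ`, `(formCongr σ T H).map Φ = formCongr τ (GL_n(Φ) T) (H.map Φ)`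
(★ `formCongr σ T H = ᵗ(σ T) H T`; `Φ.mapMatrix` is multiplicative). [cite: PlatonovRapinchuk1994, §2.3] -/
theorem formCongr_map_of_intertwines {R S : Type*} [CommRing R] [CommRing S] {n : Type*} [Fintype n] [DecidableEq n] (Φ : R ≃+* S)
    {σ : R →+* R} {τ : S →+* S} (hΦ : ∀ x, Φ (σ x) = τ (Φ x)) (T : GL n R) (H : Matrix n n R) :
    (formCongr σ T H).map (Φ : R →+* S) = formCongr τ (Matrix.GeneralLinearGroup.map (Φ : R →+* S) T) (H.map (Φ : R →+* S)) := by
  have hστ : (⇑(Φ : R →+* S) ∘ ⇑σ) = (⇑τ ∘ ⇑(Φ : R →+* S)) := funext fun x => hΦ x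
  show (((T : Matrix n n R).map σ)ᵀ * H * (T : Matrix n n R)).map (Φ : R →+* S) =
    (((T : Matrix n n R).map (Φ : R →+* S)).map τ)ᵀ * H.map (Φ : R →+* S) * (T : Matrix n n R).map (Φ : R →+* S)
  rw [Matrix.map_mul, Matrix.map_mul, Matrix.transpose_map, Matrix.map_map, Matrix.map_map, hστ]

section Brick

variable (L : Type) [Field L] [NumberField L] [IsCMField L] (v : HeightOneSpectrum (𝓞 ↥(maximalRealSubfield L)))

omit [IsCMField L] in
/-- The local split form `Φ₂ ⊗ 1` is carried to `Φ₂ ⊗ 1` by any ring isomorphism of the local rings (`0 ↦ 0`, `1 ↦ 1`). [cite: Rogawski1990, §1.9 p. 8] -/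
theorem antidiagTwo_loc_map_ringEquiv (L' : Type) [Field L'] [NumberField L'] (v' : HeightOneSpectrum (𝓞 ↥(maximalRealSubfield L')))
    (Φ : UnitaryGroup.LocalRing L v ≃+* UnitaryGroup.LocalRing L' v') :
    ((Matrix.of fun i j : Fin 2 => if i.val + j.val + 1 = 2 then (1 : L) else 0).map (algebraMap L (UnitaryGroup.LocalRing L v))).map (Φ : UnitaryGroup.LocalRing L v →+* UnitaryGroup.LocalRing L' v') =
      (Matrix.of fun i j : Fin 2 => if i.val + j.val + 1 = 2 then (1 : L') else 0).map (algebraMap L' (UnitaryGroup.LocalRing L' v')) := by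
  ext i j
  simp only [Matrix.map_apply, Matrix.of_apply]
  split_ifs <;> simp

/-! ## §1 G4 — `IsRogPacketH` is transported -/

set_option maxHeartbeats 4000000 in
/-- **G4 `stub_R90_S3_transport_rogPacketH` IN NAME-SHAPE — Rogawski `H_v`-packets are transported.**  With file B's vocabulary unfolded byte for
byte: if `ρ = O ⊠ χ₁` for a smooth character `χ₁` of `U(Φ₁)(L⁺_v)` and `O` the full similitude-conjugation orbit `{σ₀ ∘ Ad(T) : ᵗT̄ Φ₂ T = a Φ₂}` of an
admissible class `σ₀` of `U(Φ₂)(L⁺_v)`, then `ρ ∘ e_H⁻¹ = (e₂∗O) ⊠ (χ₁ ∘ e₁⁻¹)` (★ `comap_boxChar_eq`) and `e₂∗O` is the full orbit of the admissible class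
`σ₀ ∘ e₂⁻¹`: `(σ₀ ∘ Ad(T)) ∘ e₂⁻¹ = (σ₀ ∘ e₂⁻¹) ∘ Ad(ΦT)` since `e₂ ∘ Ad(T) = Ad(ΦT) ∘ e₂` entrywise (`he₂`), `ΦT` a similitude with multiplier `Φ(a)`
(`formCongr_map_of_intertwines`, `hΦσ`), and every similitude `T′` over `L′` is `Φ(Φ⁻¹T′)`.  Statement = socket G4 of `Lines/R90_S3_LocalTransportWaveG.lean`
:351 with `IsRogPacketH L v ρ` ∕ `IsRogPacketH L' v' (…)` UNFOLDED to their bodies (definitionally equal; closes by `exact`); dead frame binders carried; NOT a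
print input. [cite: Rogawski1990, §11.1 p. 161; §12.1 pp. 171–172; §14.2 p. 232] [cite: PlatonovRapinchuk1994, §2.3] -/
theorem rogPacketH_transport
    (L' : Type) [Field L'] [NumberField L'] [IsCMField L'] (v' : HeightOneSpectrum (𝓞 ↥(maximalRealSubfield L')))
    (Φ : UnitaryGroup.LocalRing L v ≃+* UnitaryGroup.LocalRing L' v') (_hc : Continuous Φ) (_hc' : Continuous Φ.symm)
    (hΦσ : ∀ x, Φ ((conjLocal L (IsCMField.complexConj L) v) x) = (conjLocal L' (IsCMField.complexConj L') v') (Φ x))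
    (μ : HeckeCharacter L) (μ' : HeckeCharacter L')
    (_hΦμ : ∀ u : (UnitaryGroup.LocalRing L v)ˣ,
      μ'.semilocalComponent L' v' (Units.map (Φ : UnitaryGroup.LocalRing L v →+* UnitaryGroup.LocalRing L' v').toMonoidHom u) = μ.semilocalComponent L v u)
    (e₂ : (UnitaryGroup.cmDatum L 2 (Matrix.of fun i j : Fin 2 => if i.val + j.val + 1 = 2 then (1 : L) else 0)).Local v ≃ₜ*
      (UnitaryGroup.cmDatum L' 2 (Matrix.of fun i j : Fin 2 => if i.val + j.val + 1 = 2 then (1 : L') else 0)).Local v')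
    (he₂ : ∀ g, ((e₂ g).val : GL (Fin 2) (UnitaryGroup.LocalRing L' v')) = Matrix.GeneralLinearGroup.map (Φ : UnitaryGroup.LocalRing L v →+* UnitaryGroup.LocalRing L' v') (g.val : GL (Fin 2) (UnitaryGroup.LocalRing L v)))
    (e₁ : (UnitaryGroup.cmDatum L 1 (Matrix.of fun i j : Fin 1 => if i.val + j.val + 1 = 1 then (1 : L) else 0)).Local v ≃ₜ*
      (UnitaryGroup.cmDatum L' 1 (Matrix.of fun i j : Fin 1 => if i.val + j.val + 1 = 1 then (1 : L') else 0)).Local v')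
    (_he₁ : ∀ g, ((e₁ g).val : GL (Fin 1) (UnitaryGroup.LocalRing L' v')) = Matrix.GeneralLinearGroup.map (Φ : UnitaryGroup.LocalRing L v →+* UnitaryGroup.LocalRing L' v') (g.val : GL (Fin 1) (UnitaryGroup.LocalRing L v)))
    (eH : ((UnitaryGroup.cmDatum L 2 (Matrix.of fun i j : Fin 2 => if i.val + j.val + 1 = 2 then (1 : L) else 0)).Local v ×
      (UnitaryGroup.cmDatum L 1 (Matrix.of fun i j : Fin 1 => if i.val + j.val + 1 = 1 then (1 : L) else 0)).Local v) ≃ₜ*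
      ((UnitaryGroup.cmDatum L' 2 (Matrix.of fun i j : Fin 2 => if i.val + j.val + 1 = 2 then (1 : L') else 0)).Local v' ×
      (UnitaryGroup.cmDatum L' 1 (Matrix.of fun i j : Fin 1 => if i.val + j.val + 1 = 1 then (1 : L') else 0)).Local v'))
    (heH : ∀ h, eH h = (e₂ h.1, e₁ h.2))
    (ρ : Finset (IrrClass ((UnitaryGroup.cmDatum L 2 (Matrix.of fun i j : Fin 2 => if i.val + j.val + 1 = 2 then (1 : L) else 0)).Local v ×
      (UnitaryGroup.cmDatum L 1 (Matrix.of fun i j : Fin 1 => if i.val + j.val + 1 = 1 then (1 : L) else 0)).Local v)))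
    (hρ : (∃ (O : Finset (IrrClass ((UnitaryGroup.cmDatum L 2 (Matrix.of fun i j : Fin 2 => if i.val + j.val + 1 = 2 then (1 : L) else 0)).Local v)))
        (χ : (UnitaryGroup.cmDatum L 1 (Matrix.of fun i j : Fin 1 => if i.val + j.val + 1 = 1 then (1 : L) else 0)).Local v →* ℂˣ)
        (hχ : IsOpen ((χ.ker : Subgroup ((UnitaryGroup.cmDatum L 1 (Matrix.of fun i j : Fin 1 => if i.val + j.val + 1 = 1 then (1 : L) else 0)).Local v)) : Set ((UnitaryGroup.cmDatum L 1 (Matrix.of fun i j : Fin 1 => if i.val + j.val + 1 = 1 then (1 : L) else 0)).Local v))),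
        (∃ σ : IrrClass ((UnitaryGroup.cmDatum L 2 (Matrix.of fun i j : Fin 2 => if i.val + j.val + 1 = 2 then (1 : L) else 0)).Local v),
            σ.IsAdmissible ∧
              ∀ c, c ∈ O ↔
                ∃ (T : GL (Fin 2) (UnitaryGroup.LocalRing L v)) (a : UnitaryGroup.LocalRing L v) (ha : IsUnit a)
                  (h : formCongr (conjLocal L (IsCMField.complexConj L) v) T ((Matrix.of fun i j : Fin 2 => if i.val + j.val + 1 = 2 then (1 : L) else 0).map (algebraMap L (UnitaryGroup.LocalRing L v))) =
                    a • (Matrix.of fun i j : Fin 2 => if i.val + j.val + 1 = 2 then (1 : L) else 0).map (algebraMap L (UnitaryGroup.LocalRing L v))),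
                  c = IrrClass.comap (cmDatumLocalCongr L v T ha h) σ) ∧
          ρ = O.map ⟨IrrClass.boxChar χ hχ, IrrClass.boxChar_injective χ hχ⟩)) :
    (∃ (O : Finset (IrrClass ((UnitaryGroup.cmDatum L' 2 (Matrix.of fun i j : Fin 2 => if i.val + j.val + 1 = 2 then (1 : L') else 0)).Local v')))
        (χ : (UnitaryGroup.cmDatum L' 1 (Matrix.of fun i j : Fin 1 => if i.val + j.val + 1 = 1 then (1 : L') else 0)).Local v' →* ℂˣ)
        (hχ : IsOpen ((χ.ker : Subgroup ((UnitaryGroup.cmDatum L' 1 (Matrix.of fun i j : Fin 1 => if i.val + j.val + 1 = 1 then (1 : L') else 0)).Local v')) : Set ((UnitaryGroup.cmDatum L' 1 (Matrix.of fun i j : Fin 1 => if i.val + j.val + 1 = 1 then (1 : L') else 0)).Local v'))),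
        (∃ σ : IrrClass ((UnitaryGroup.cmDatum L' 2 (Matrix.of fun i j : Fin 2 => if i.val + j.val + 1 = 2 then (1 : L') else 0)).Local v'),
            σ.IsAdmissible ∧
              ∀ c, c ∈ O ↔
                ∃ (T : GL (Fin 2) (UnitaryGroup.LocalRing L' v')) (a : UnitaryGroup.LocalRing L' v') (ha : IsUnit a)
                  (h : formCongr (conjLocal L' (IsCMField.complexConj L') v') T ((Matrix.of fun i j : Fin 2 => if i.val + j.val + 1 = 2 then (1 : L') else 0).map (algebraMap L' (UnitaryGroup.LocalRing L' v'))) =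
                    a • (Matrix.of fun i j : Fin 2 => if i.val + j.val + 1 = 2 then (1 : L') else 0).map (algebraMap L' (UnitaryGroup.LocalRing L' v'))),
                  c = IrrClass.comap (cmDatumLocalCongr L' v' T ha h) σ) ∧
          ρ.map (IrrClass.comapEquiv eH.symm).toEmbedding = O.map ⟨IrrClass.boxChar χ hχ, IrrClass.boxChar_injective χ hχ⟩) := by
  -- (0) notation-free abbreviations and the two matrix facts
  have hΦσ' : ∀ y, Φ.symm ((conjLocal L' (IsCMField.complexConj L') v') y) = (conjLocal L (IsCMField.complexConj L) v) (Φ.symm y) :=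
    fun y => Φ.injective (by rw [Φ.apply_symm_apply, hΦσ, Φ.apply_symm_apply])
  have he₂' : ∀ g' : (UnitaryGroup.cmDatum L' 2 (Matrix.of fun i j : Fin 2 => if i.val + j.val + 1 = 2 then (1 : L') else 0)).Local v', ((e₂.symm g').val : GL (Fin 2) (UnitaryGroup.LocalRing L v)) =
      Matrix.GeneralLinearGroup.map (Φ.symm : UnitaryGroup.LocalRing L' v' →+* UnitaryGroup.LocalRing L v) (g'.val : GL (Fin 2) (UnitaryGroup.LocalRing L' v')) :=
    fun g' => transport_symm_val L v L' v' Φ e₂ he₂ g'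
  -- a similitude `T′` of `(Φ₂)_{v′}` pulls back to the similitude `Φ⁻¹T′` of `(Φ₂)_v` with multiplier `Φ⁻¹(a′)`
  have hform : ∀ (T' : GL (Fin 2) (UnitaryGroup.LocalRing L' v')) (a' : UnitaryGroup.LocalRing L' v'),
      formCongr (conjLocal L' (IsCMField.complexConj L') v') T' ((Matrix.of fun i j : Fin 2 => if i.val + j.val + 1 = 2 then (1 : L') else 0).map (algebraMap L' (UnitaryGroup.LocalRing L' v'))) =
        a' • (Matrix.of fun i j : Fin 2 => if i.val + j.val + 1 = 2 then (1 : L') else 0).map (algebraMap L' (UnitaryGroup.LocalRing L' v')) →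
      formCongr (conjLocal L (IsCMField.complexConj L) v) (Matrix.GeneralLinearGroup.map (Φ.symm : UnitaryGroup.LocalRing L' v' →+* UnitaryGroup.LocalRing L v) T')
          ((Matrix.of fun i j : Fin 2 => if i.val + j.val + 1 = 2 then (1 : L) else 0).map (algebraMap L (UnitaryGroup.LocalRing L v))) =
        Φ.symm a' • (Matrix.of fun i j : Fin 2 => if i.val + j.val + 1 = 2 then (1 : L) else 0).map (algebraMap L (UnitaryGroup.LocalRing L v)) := by
    intro T' a' h'
    have h1 : (formCongr (conjLocal L' (IsCMField.complexConj L') v') T' ((Matrix.of fun i j : Fin 2 => if i.val + j.val + 1 = 2 then (1 : L') else 0).map (algebraMap L' (UnitaryGroup.LocalRing L' v')))).map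
        (Φ.symm : UnitaryGroup.LocalRing L' v' →+* UnitaryGroup.LocalRing L v) = (a' • (Matrix.of fun i j : Fin 2 => if i.val + j.val + 1 = 2 then (1 : L') else 0).map (algebraMap L' (UnitaryGroup.LocalRing L' v'))).map (Φ.symm : UnitaryGroup.LocalRing L' v' →+* UnitaryGroup.LocalRing L v) := by rw [h']
    rw [formCongr_map_of_intertwines Φ.symm hΦσ' T', antidiagTwo_loc_map_ringEquiv L' v' L v Φ.symm] at h1
    rw [h1]
    ext i j
    rw [Matrix.map_apply, Matrix.smul_apply, Matrix.smul_apply, smul_eq_mul, smul_eq_mul, map_mul,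
      ← antidiagTwo_loc_map_ringEquiv L' v' L v Φ.symm, Matrix.map_apply]
    rfl
  -- `e₂⁻¹ ∘ Ad(T′) = Ad(Φ⁻¹T′) ∘ e₂⁻¹` as identifications `U(Φ₂)(L′⁺_{v′}) ≃ₜ* U(Φ₂)(L⁺_v)`, hence the same pull-back of classes
  have hconj : ∀ (T' : GL (Fin 2) (UnitaryGroup.LocalRing L' v')) (a' : UnitaryGroup.LocalRing L' v') (ha' : IsUnit a')
      (h' : formCongr (conjLocal L' (IsCMField.complexConj L') v') T' ((Matrix.of fun i j : Fin 2 => if i.val + j.val + 1 = 2 then (1 : L') else 0).map (algebraMap L' (UnitaryGroup.LocalRing L' v'))) =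
        a' • (Matrix.of fun i j : Fin 2 => if i.val + j.val + 1 = 2 then (1 : L') else 0).map (algebraMap L' (UnitaryGroup.LocalRing L' v')))
      (c : IrrClass ((UnitaryGroup.cmDatum L 2 (Matrix.of fun i j : Fin 2 => if i.val + j.val + 1 = 2 then (1 : L) else 0)).Local v)),
      IrrClass.comap e₂.symm (IrrClass.comap (cmDatumLocalCongr L v (Matrix.GeneralLinearGroup.map (Φ.symm : UnitaryGroup.LocalRing L' v' →+* UnitaryGroup.LocalRing L v) T')
        ((ha'.map Φ.symm)) (hform T' a' h')) c) =
      IrrClass.comap (cmDatumLocalCongr L' v' T' ha' h') (IrrClass.comap e₂.symm c) := by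
    intro T' a' ha' h' c
    rw [IrrClass.comap_comap, IrrClass.comap_comap]
    refine IrrClass.comap_eq_comap_of_forall_eq_conj _ _ 1 (fun g' => ?_) c
    rw [one_mul, inv_one, mul_one]
    apply Subtype.ext
    change ((e₂.symm (cmDatumLocalCongr L' v' T' ha' h' g')).val : GL (Fin 2) (UnitaryGroup.LocalRing L v)) =
      ((cmDatumLocalCongr L v (Matrix.GeneralLinearGroup.map (Φ.symm : UnitaryGroup.LocalRing L' v' →+* UnitaryGroup.LocalRing L v) T') (ha'.map Φ.symm) (hform T' a' h')
        (e₂.symm g')).val : GL (Fin 2) (UnitaryGroup.LocalRing L v))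
    rw [he₂', coe_cmDatumLocalCongr_apply, coe_cmDatumLocalCongr_apply, map_mul, map_mul, map_inv, he₂']
  -- (1) unpack `ρ = O ⊠ χ₁`, `O` = orbit of the admissible `σ₀`
  obtain ⟨O, χ, hχ, ⟨σ₀, hσ₀, hO⟩, rfl⟩ := hρ
  have hχ' : IsOpen (((χ.comp (e₁.symm : (UnitaryGroup.cmDatum L' 1 (Matrix.of fun i j : Fin 1 => if i.val + j.val + 1 = 1 then (1 : L') else 0)).Local v' →* (UnitaryGroup.cmDatum L 1 (Matrix.of fun i j : Fin 1 => if i.val + j.val + 1 = 1 then (1 : L) else 0)).Local v)).ker : Subgroup ((UnitaryGroup.cmDatum L' 1 (Matrix.of fun i j : Fin 1 => if i.val + j.val + 1 = 1 then (1 : L') else 0)).Local v')) : Set ((UnitaryGroup.cmDatum L' 1 (Matrix.of fun i j : Fin 1 => if i.val + j.val + 1 = 1 then (1 : L') else 0)).Local v')) := by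
    rw [← MonoidHom.comap_ker, Subgroup.coe_comap]; exact hχ.preimage e₁.symm.continuous
  refine ⟨O.map (IrrClass.comapEquiv e₂.symm).toEmbedding, χ.comp (e₁.symm : (UnitaryGroup.cmDatum L' 1 (Matrix.of fun i j : Fin 1 => if i.val + j.val + 1 = 1 then (1 : L') else 0)).Local v' →* (UnitaryGroup.cmDatum L 1 (Matrix.of fun i j : Fin 1 => if i.val + j.val + 1 = 1 then (1 : L) else 0)).Local v), hχ',
    ⟨IrrClass.comap e₂.symm σ₀, hσ₀.comap e₂.symm, fun c' => ?_⟩, ?_⟩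
  · -- (2) `e₂∗O` is the full similitude orbit of `σ₀ ∘ e₂⁻¹`
    rw [Finset.mem_map]
    constructor
    · rintro ⟨c, hc, rfl⟩
      obtain ⟨T, a, ha, h, rfl⟩ := (hO c).1 hc
      -- `T = Φ⁻¹(ΦT)`: the transported similitude `ΦT` of `(Φ₂)_{v′}` with multiplier `Φ a`
      have hΦT : formCongr (conjLocal L' (IsCMField.complexConj L') v') (Matrix.GeneralLinearGroup.map (Φ : UnitaryGroup.LocalRing L v →+* UnitaryGroup.LocalRing L' v') T)
          ((Matrix.of fun i j : Fin 2 => if i.val + j.val + 1 = 2 then (1 : L') else 0).map (algebraMap L' (UnitaryGroup.LocalRing L' v'))) = Φ a • (Matrix.of fun i j : Fin 2 => if i.val + j.val + 1 = 2 then (1 : L') else 0).map (algebraMap L' (UnitaryGroup.LocalRing L' v')) := by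
        have h1 : (formCongr (conjLocal L (IsCMField.complexConj L) v) T ((Matrix.of fun i j : Fin 2 => if i.val + j.val + 1 = 2 then (1 : L) else 0).map (algebraMap L (UnitaryGroup.LocalRing L v)))).map
            (Φ : UnitaryGroup.LocalRing L v →+* UnitaryGroup.LocalRing L' v') = (a • (Matrix.of fun i j : Fin 2 => if i.val + j.val + 1 = 2 then (1 : L) else 0).map (algebraMap L (UnitaryGroup.LocalRing L v))).map (Φ : UnitaryGroup.LocalRing L v →+* UnitaryGroup.LocalRing L' v') := by rw [h]
        rw [formCongr_map_of_intertwines Φ hΦσ T, antidiagTwo_loc_map_ringEquiv L v L' v' Φ] at h1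
        rw [h1]
        ext i j
        rw [Matrix.map_apply, Matrix.smul_apply, Matrix.smul_apply, smul_eq_mul, smul_eq_mul, map_mul,
          ← antidiagTwo_loc_map_ringEquiv L v L' v' Φ, Matrix.map_apply]
        rfl
      refine ⟨Matrix.GeneralLinearGroup.map (Φ : UnitaryGroup.LocalRing L v →+* UnitaryGroup.LocalRing L' v') T, Φ a, ha.map Φ, hΦT, ?_⟩
      have hback : Matrix.GeneralLinearGroup.map (Φ.symm : UnitaryGroup.LocalRing L' v' →+* UnitaryGroup.LocalRing L v) (Matrix.GeneralLinearGroup.map (Φ : UnitaryGroup.LocalRing L v →+* UnitaryGroup.LocalRing L' v') T) = T :=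
        Units.ext (Matrix.ext fun i j => Φ.symm_apply_apply _)
      rw [← hconj _ _ (ha.map Φ) hΦT σ₀]
      -- the two pinned conjugations `Ad(Φ⁻¹(ΦT))` and `Ad(T)` are the same map
      change IrrClass.comap e₂.symm (IrrClass.comap (cmDatumLocalCongr L v T ha h) σ₀) = _
      congr 1
      exact IrrClass.comap_eq_comap_of_forall_eq_conj _ _ 1 (fun g => by
        rw [one_mul, inv_one, mul_one]; apply Subtype.ext
        rw [coe_cmDatumLocalCongr_apply, coe_cmDatumLocalCongr_apply, hback]) σ₀
    · rintro ⟨T', a', ha', h', rfl⟩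
      refine ⟨IrrClass.comap (cmDatumLocalCongr L v (Matrix.GeneralLinearGroup.map (Φ.symm : UnitaryGroup.LocalRing L' v' →+* UnitaryGroup.LocalRing L v) T') (ha'.map Φ.symm) (hform T' a' h')) σ₀,
        (hO _).2 ⟨_, _, _, _, rfl⟩, hconj T' a' ha' h' σ₀⟩
  · -- (3) `(O ⊠ χ₁) ∘ e_H⁻¹ = (e₂∗O) ⊠ (χ₁ ∘ e₁⁻¹)` classwise
    rw [Finset.map_map, Finset.map_map]
    congr 1
    exact DFunLike.ext _ _ fun c => comap_boxChar_eq e₂ e₁ eH heH χ hχ _ c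

end Brick

end Summit.HodgeConjecture.HodgeConjecture.R90.S3

end
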